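import Summits.NavierStokesRegularity.NavierStokesRegularity.Theorems.ExtremiserTransienceNearExtremalTransienceExtremiserLiouvilleConstantSpeedGlobalVariation
import Summits.NavierStokesRegularity.NavierStokesRegularity.Theorems.ExtremiserTransienceNearExtremalTransienceExtremiserLiouvilleConstantSpeedHemisphere
import HarnessLib

/-!
# Crux `ExtremiserTransience.NearExtremalTransience` (stmt-NavierStokesRegularity-21883), line `extremiser_liouville`,
# stub K1b — KKT ON THE CONVEX COMPETITOR SET `{u : ‖c + u‖ ≤ M + η}` (global form)

`--supports stmt-NavierStokesRegularity-21883` (helper).  Author: prover seat `ns-el-k1b` (g5).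

The extended admissible class with the sup-norm constraint `‖c + u‖ ≤ M` is CONVEX and contains the residue object's deviation
`v − c`; with g2's `extendedSharp` the residue object maximises the quartic `S(u)² − κ⋆²M²Z(u)W(u)` over it, hence the LINEAR
first variation `ℓ(ψ) = S·J₁(ψ) − κ⋆²M²(W a₁(ψ) + Z c₁(ψ))` satisfies `ℓ(u − (v − c)) ≤ 0` for every competitor `u` — including
NON-compactly-supported ones (constants, translates, mollifications, AXIAL TRUNCATIONS `g(ξ)(v − c)`, for which
`‖c + g(v − c)‖² = M² − g(1−g)‖v − c‖²`), which the multiplier measure `μ` of `…ConstantSpeedMultiplierMeasure` cannot see.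

* `firstVar_stretching_self`, `firstVar_enstrophy_self`, `firstVar_palinstrophy_self` : `J₁(v − c) = 3S`, `a₁(v − c) = Z`,
  `c₁(v − c) = W` (so `ℓ(v − c) = 3S² − 2κ⋆²M²ZW = S²`);
* `firstVariation_le_of_norm_add_le_global` : **for every `u` of the global tangent class (`C^∞`, divergence free, `‖Du‖ ≤ C`,
  `D¹u, D²u ∈ L²`) with `‖c + u(x)‖ ≤ M + η` for all `x`:
  `S·J₁(u) − κ⋆²M²(W a₁(u) + Z c₁(u)) ≤ 3S² − 2κ⋆²M²ZW + κ⋆²MZW·η`** (`= S² + κ⋆²MZW·η`) — from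
  `ext_firstVariation_le_of_oneSided_normBound_global` along `ψ = u − (v − c)` (the chord `(1−ε)v + ε(c + u)` has norm
  `≤ M + εη`) and linearity of `J₁, a₁, c₁`.

USE: step (i) of the axial-truncation attack on the JET alternative of the K1b residue (`Lines/extremiser_liouville_k1b_jet.md` §4):
with `u ≈ (1 − g(ξ))(v − c)` + solenoidal corrector of sup-norm `η`, the inequality reads `κ⋆²M²(W Z_g + Z W_g) ≤ 3S·S_g + err`.

WHAT THIS IS NOT: K1b is NOT proved; the truncation competitor (step (ii)) is not constructed here; nothing here proves NS regularity. [folklore]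
-/

noncomputable section

open Set Filter Topology MeasureTheory Metric Function
open scoped ENNReal NNReal Topology InnerProductSpace RealInnerProductSpace ContDiff
open Literature.Analysis.FluidPDE Literature.Analysis

namespace Summit.NavierStokesRegularity.NavierStokesRegularity.Theorems

-- the problem directory repeats the summit name (`NavierStokesRegularity/NavierStokesRegularity`)
set_option linter.dupNamespace false

namespace ExtremiserLiouville

open DepletionLadder.KStar

/-! ## The convex competitor set `K = {u : ‖c + u‖ ≤ M + η}` and the KKT inequality `ℓ(u) ≤ S² + κ⋆²MZW·η` -/

section ConvexKKT

variable {v u : EuclideanSpace ℝ (Fin 3) → EuclideanSpace ℝ (Fin 3)} {c : EuclideanSpace ℝ (Fin 3)}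

/-- `J₁(v − c) = 3S`: along its own deviation the first variation of the (trilinear) stretching integral is three times
the stretching. [folklore] -/
theorem firstVar_stretching_self (v : EuclideanSpace ℝ (Fin 3) → EuclideanSpace ℝ (Fin 3)) (c : EuclideanSpace ℝ (Fin 3)) :
    (∫ x, (⟪curl (fun y => v y - c) x, fderiv ℝ v x (curl v x)⟫ + ⟪curl v x, fderiv ℝ (fun y => v y - c) x (curl v x)⟫ +
        ⟪curl v x, fderiv ℝ v x (curl (fun y => v y - c) x)⟫)) = 3 * ∫ x, ⟪curl v x, fderiv ℝ v x (curl v x)⟫ := by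
  rw [← integral_const_mul]
  congr 1
  funext x
  rw [curl_sub_const, fderiv_sub_const]
  ring

/-- `a₁(v − c) = Z`. [folklore] -/
theorem firstVar_enstrophy_self (v : EuclideanSpace ℝ (Fin 3) → EuclideanSpace ℝ (Fin 3)) (c : EuclideanSpace ℝ (Fin 3)) :
    (∫ x, ⟪curl v x, curl (fun y => v y - c) x⟫) = ∫ x, ‖curl v x‖ ^ 2 := by
  congr 1; funext x; rw [curl_sub_const, real_inner_self_eq_norm_sq]

/-- `c₁(v − c) = W`. [folklore] -/
theorem firstVar_palinstrophy_self (v : EuclideanSpace ℝ (Fin 3) → EuclideanSpace ℝ (Fin 3)) (c : EuclideanSpace ℝ (Fin 3)) :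
    (∫ x, ∑ i, ⟪fderiv ℝ (curl v) x (EuclideanSpace.basisFun (Fin 3) ℝ i),
        fderiv ℝ (curl (fun y => v y - c)) x (EuclideanSpace.basisFun (Fin 3) ℝ i)⟫) =
      ∫ x, frobeniusNormSq (fderiv ℝ (curl v) x) := by
  congr 1; funext x
  rw [curl_sub_const, frobeniusNormSq_eq_sum (EuclideanSpace.basisFun (Fin 3) ℝ)]
  exact Finset.sum_congr rfl fun i _ => real_inner_self_eq_norm_sq _

/-- **KKT ON THE CONVEX COMPETITOR SET (global form).**  Let `v` be a constant-speed extended extremiser (`‖v‖ ≡ M > 0`,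
`C^∞`, divergence free, `‖Dv‖ ≤ B`, `D¹v, D²v ∈ L²`, `|S| = κ⋆M√Z√W`) and `c` any constant (e.g. its far field).  For EVERY
`u` of the global tangent class (`C^∞`, divergence free, `‖Du‖ ≤ C`, `D¹u, D²u ∈ L²`) with **`‖c + u(x)‖ ≤ M + η`** for all `x`
(`η ∈ ℝ`, typically the sup-norm excess `η ≥ 0` of a competitor):
`S·J₁(u) − κ⋆²M²(W a₁(u) + Z c₁(u)) ≤ 3S² − 2κ⋆²M²ZW + κ⋆²·M·Z·W·η` (`= S² + κ⋆²MZW·η` since `S² = κ⋆²M²ZW`),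
i.e. **`ℓ(u) ≤ ℓ(v − c) + κ⋆²MZW·η`**: the residue object maximises the linear functional `ℓ` over the convex set
`{u : ‖c + u‖ ≤ M}` — constants, translates, mollifications and AXIAL TRUNCATIONS `g(ξ)(v − c)` (`‖c + g(v−c)‖² = M² − g(1−g)‖v−c‖²`)
included, none of which the compactly supported multiplier `μ` sees.  Proof: the chord `v + ε(u − (v − c)) = (1−ε)v + ε(c + u)` has
norm `≤ M + εη`; apply `ext_firstVariation_le_of_oneSided_normBound_global` to `ψ = u − (v − c)` and linearity. [folklore] -/
theorem firstVariation_le_of_norm_add_le_global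
    (hv : ContDiff ℝ ∞ v) (hdiv : VectorCalculus.IsDivFree v) {M B : ℝ} (hMpos : 0 < M)
    (hM : ∀ x, ‖v x‖ = M) (hB : ∀ x, ‖fderiv ℝ v x‖ ≤ B)
    (h1 : ∫⁻ x, ‖iteratedFDeriv ℝ 1 v x‖ₑ ^ 2 < ⊤) (h2 : ∫⁻ x, ‖iteratedFDeriv ℝ 2 v x‖ₑ ^ 2 < ⊤)
    (hatt : |∫ x, ⟪curl v x, fderiv ℝ v x (curl v x)⟫| = (sInf {κ : ℝ | (∀ (v : EuclideanSpace ℝ (Fin 3) → EuclideanSpace ℝ (Fin 3)) (M B : ℝ), ContDiff ℝ (⊤ : ℕ∞) v → Literature.Analysis.FluidPDE.VectorCalculus.IsDivFree v → (∀ x, ‖v x‖ ≤ M) → (∀ x, ‖fderiv ℝ v x‖ ≤ B) → (∫⁻ x, ‖iteratedFDeriv ℝ 0 v x‖ₑ ^ 2 < ⊤) → (∫⁻ x, ‖iteratedFDeriv ℝ 1 v x‖ₑ ^ 2 < ⊤) → (∫⁻ x, ‖iteratedFDeriv ℝ 2 v x‖ₑ ^ 2 < ⊤) → |∫ x, ⟪Literature.Analysis.FluidPDE.curl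 v x, fderiv ℝ v x (Literature.Analysis.FluidPDE.curl v x)⟫_ℝ| ≤ κ * M * Real.sqrt (∫ x, ‖Literature.Analysis.FluidPDE.curl v x‖ ^ 2) * Real.sqrt (∫ x, Literature.Analysis.FluidPDE.frobeniusNormSq (fderiv ℝ (Literature.Analysis.FluidPDE.curl v) x)))}) * M * Real.sqrt (∫ x, ‖curl v x‖ ^ 2) * Real.sqrt (∫ x, frobeniusNormSq (fderiv ℝ (curl v) x)))
    (hu : ContDiff ℝ ∞ u) (hudiv : VectorCalculus.IsDivFree u) {C : ℝ} (hC : ∀ x, ‖fderiv ℝ u x‖ ≤ C)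
    (h1u : ∫⁻ x, ‖iteratedFDeriv ℝ 1 u x‖ₑ ^ 2 < ⊤) (h2u : ∫⁻ x, ‖iteratedFDeriv ℝ 2 u x‖ₑ ^ 2 < ⊤)
    {η : ℝ} (hball : ∀ x, ‖c + u x‖ ≤ M + η) :
    (∫ x, ⟪curl v x, fderiv ℝ v x (curl v x)⟫) *
        (∫ x, (⟪curl u x, fderiv ℝ v x (curl v x)⟫ + ⟪curl v x, fderiv ℝ u x (curl v x)⟫ + ⟪curl v x, fderiv ℝ v x (curl u x)⟫)) -
      (sInf {κ : ℝ | (∀ (v : EuclideanSpace ℝ (Fin 3) → EuclideanSpace ℝ (Fin 3)) (M B : ℝ), ContDiff ℝ (⊤ : ℕ∞) v → Literature.Analysis.FluidPDE.VectorCalculus.IsDivFree v → (∀ x, ‖v x‖ ≤ M) → (∀ x, ‖fderiv ℝ v x‖ ≤ B) → (∫⁻ x, ‖iteratedFDeriv ℝ 0 v x‖ₑ ^ 2 < ⊤) → (∫⁻ x, ‖iteratedFDeriv ℝ 1 v x‖ₑ ^ 2 < ⊤) → (∫⁻ x, ‖iteratedFDeriv ℝ 2 v x‖ₑ ^ 2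 < ⊤) → |∫ x, ⟪Literature.Analysis.FluidPDE.curl v x, fderiv ℝ v x (Literature.Analysis.FluidPDE.curl v x)⟫_ℝ| ≤ κ * M * Real.sqrt (∫ x, ‖Literature.Analysis.FluidPDE.curl v x‖ ^ 2) * Real.sqrt (∫ x, Literature.Analysis.FluidPDE.frobeniusNormSq (fderiv ℝ (Literature.Analysis.FluidPDE.curl v) x)))}) ^ 2 * M ^ 2 * ((∫ x, frobeniusNormSq (fderiv ℝ (curl v) x)) * (∫ x, ⟪curl v x, curl u x⟫) +
        (∫ x, ‖curl v x‖ ^ 2) * (∫ x, ∑ i, ⟪fderiv ℝ (curl v) x (EuclideanSpace.basisFun (Fin 3) ℝ i), fderiv ℝ (curl u) x (EuclideanSpace.basisFun (Fin 3) ℝ i)⟫)) ≤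
      3 * (∫ x, ⟪curl v x, fderiv ℝ v x (curl v x)⟫) ^ 2 -
        2 * (sInf {κ : ℝ | (∀ (v : EuclideanSpace ℝ (Fin 3) → EuclideanSpace ℝ (Fin 3)) (M B : ℝ), ContDiff ℝ (⊤ : ℕ∞) v → Literature.Analysis.FluidPDE.VectorCalculus.IsDivFree v → (∀ x, ‖v x‖ ≤ M) → (∀ x, ‖fderiv ℝ v x‖ ≤ B) → (∫⁻ x, ‖iteratedFDeriv ℝ 0 v x‖ₑ ^ 2 < ⊤) → (∫⁻ x, ‖iteratedFDeriv ℝ 1 v x‖ₑ ^ 2 < ⊤) → (∫⁻ x, ‖iteratedFDeriv ℝ 2 v x‖ₑ ^ 2 < ⊤) → |∫ x, ⟪Literature.Analysis.FluidPDE.curl v x, fderiv ℝ v x (Literature.Analysis.FluidPDE.curl v x)⟫_ℝ| ≤ κ * M * Real.sqrt (∫ x, ‖Literature.Analysis.FluidPDE.curl v x‖ ^ 2) * Real.sqrt (∫ x, Literature.Analysis.FluidPDE.frobeniusNormSq (fderiv ℝ (Literature.Analysis.FluidPDE.curl v) x)))}) ^ 2 * M ^ 2 * (∫ x, ‖curl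 v x‖ ^ 2) * (∫ x, frobeniusNormSq (fderiv ℝ (curl v) x)) +
        (sInf {κ : ℝ | (∀ (v : EuclideanSpace ℝ (Fin 3) → EuclideanSpace ℝ (Fin 3)) (M B : ℝ), ContDiff ℝ (⊤ : ℕ∞) v → Literature.Analysis.FluidPDE.VectorCalculus.IsDivFree v → (∀ x, ‖v x‖ ≤ M) → (∀ x, ‖fderiv ℝ v x‖ ≤ B) → (∫⁻ x, ‖iteratedFDeriv ℝ 0 v x‖ₑ ^ 2 < ⊤) → (∫⁻ x, ‖iteratedFDeriv ℝ 1 v x‖ₑ ^ 2 < ⊤) → (∫⁻ x, ‖iteratedFDeriv ℝ 2 v x‖ₑ ^ 2 < ⊤) → |∫ x, ⟪Literature.Analysis.FluidPDE.curl v x, fderiv ℝ v x (Literature.Analysis.FluidPDE.curl v x)⟫_ℝ| ≤ κ * M * Real.sqrt (∫ x, ‖Literature.Analysis.FluidPDE.curl v x‖ ^ 2) * Real.sqrt (∫ x, Literature.Analysis.FluidPDE.frobeniusNormSq (fderiv ℝ (Literature.Analysis.FluidPDE.curl v) x)))}) ^ 2 * M * (∫ x, ‖curl v x‖ ^ 2)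 * (∫ x, frobeniusNormSq (fderiv ℝ (curl v) x)) * η := by
  set K : ℝ := (sInf {κ : ℝ | (∀ (v : EuclideanSpace ℝ (Fin 3) → EuclideanSpace ℝ (Fin 3)) (M B : ℝ), ContDiff ℝ (⊤ : ℕ∞) v → Literature.Analysis.FluidPDE.VectorCalculus.IsDivFree v → (∀ x, ‖v x‖ ≤ M) → (∀ x, ‖fderiv ℝ v x‖ ≤ B) → (∫⁻ x, ‖iteratedFDeriv ℝ 0 v x‖ₑ ^ 2 < ⊤) → (∫⁻ x, ‖iteratedFDeriv ℝ 1 v x‖ₑ ^ 2 < ⊤) → (∫⁻ x, ‖iteratedFDeriv ℝ 2 v x‖ₑ ^ 2 < ⊤) → |∫ x, ⟪Literature.Analysis.FluidPDE.curl v x, fderiv ℝ v x (Literature.Analysis.FluidPDE.curl v x)⟫_ℝ| ≤ κ * M * Real.sqrt (∫ x, ‖Literature.Analysis.FluidPDE.curl v x‖ ^ 2) * Real.sqrt (∫ x, Literature.Analysis.FluidPDE.frobeniusNormSq (fderiv ℝ (Literature.Analysis.FluidPDE.curl v) x)))}) with hK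
  -- the direction `ψ = u − (v − c)`
  set V : EuclideanSpace ℝ (Fin 3) → EuclideanSpace ℝ (Fin 3) := fun y => v y - c with hVdef
  set ψ : EuclideanSpace ℝ (Fin 3) → EuclideanSpace ℝ (Fin 3) := fun y => u y - V y with hψdef
  have hvd : Differentiable ℝ v := hv.differentiable (by simp)
  have hud : Differentiable ℝ u := hu.differentiable (by simp)
  have hV : ContDiff ℝ ∞ V := hv.sub contDiff_const
  have hVd : Differentiable ℝ V := hV.differentiable (by simp)
  have hψ : ContDiff ℝ ∞ ψ := hu.sub hV
  have hψeq : ψ = fun y => u y + (-1 : ℝ) • V y := by funext y; simp [hψdef, sub_eq_add_neg]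
  have hVdiv : VectorCalculus.IsDivFree V := isDivFree_sub_const hdiv c
  have hψdiv : VectorCalculus.IsDivFree ψ := fun x => by
    rw [hψeq, divergence_add_smul hud hVd, hudiv x, hVdiv x, mul_zero, add_zero]
  have hDV : ∀ x, fderiv ℝ V x = fderiv ℝ v x := fun x => by simp only [hVdef]; rw [fderiv_sub_const]
  have hDψ' : ∀ x, fderiv ℝ ψ x = fderiv ℝ u x - fderiv ℝ V x := fun x => by
    rw [hψdef]; exact fderiv_sub (hud x) (hVd x)
  have hψC : ∀ x, ‖fderiv ℝ ψ x‖ ≤ C + B := fun x => by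
    rw [hDψ', hDV]
    exact (norm_sub_le _ _).trans (add_le_add (hC x) (hB x))
  have hVk : ∀ k : ℕ, k ≠ 0 → (∫⁻ x, ‖iteratedFDeriv ℝ k v x‖ₑ ^ 2 < ⊤) → ∫⁻ x, ‖iteratedFDeriv ℝ k V x‖ₑ ^ 2 < ⊤ := by
    intro k hk hkv
    have e : (fun x => ‖iteratedFDeriv ℝ k V x‖ₑ ^ 2) = fun x => ‖iteratedFDeriv ℝ k v x‖ₑ ^ 2 := by
      funext x; rw [iteratedFDeriv_sub_const_of_ne hv c hk]
    rw [e]; exact hkv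
  have hψ1 : ∫⁻ x, ‖iteratedFDeriv ℝ 1 ψ x‖ₑ ^ 2 < ⊤ := by
    rw [hψeq]; exact lintegral_iteratedFDeriv_add_smul_lt_top_global hu hV (-1) h1u (hVk 1 one_ne_zero h1)
  have hψ2 : ∫⁻ x, ‖iteratedFDeriv ℝ 2 ψ x‖ₑ ^ 2 < ⊤ := by
    rw [hψeq]; exact lintegral_iteratedFDeriv_add_smul_lt_top_global hu hV (-1) h2u (hVk 2 two_ne_zero h2)
  -- the chord stays in the ball of radius `M + εη`
  have hbound : ∀ ε : ℝ, 0 ≤ ε → ε < 1 → ∀ x, ‖v x + ε • ψ x‖ ≤ (1 + η / M * ε) * M := by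
    intro ε hε0 hε1 x
    have e : v x + ε • ψ x = (1 - ε) • v x + ε • (c + u x) := by
      simp only [hψdef, hVdef, smul_sub, smul_add, sub_smul, one_smul]; abel
    rw [e]
    calc ‖(1 - ε) • v x + ε • (c + u x)‖ ≤ ‖(1 - ε) • v x‖ + ‖ε • (c + u x)‖ := norm_add_le _ _
      _ = (1 - ε) * M + ε * ‖c + u x‖ := by
          rw [norm_smul, norm_smul, Real.norm_eq_abs, Real.norm_eq_abs, abs_of_nonneg (by linarith), abs_of_nonneg hε0, hM]
      _ ≤ (1 - ε) * M + ε * (M + η) := by gcongr; exact hball x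
      _ = (1 + η / M * ε) * M := by field_simp; ring
  have hmain := ext_firstVariation_le_of_oneSided_normBound_global hv hdiv hB h1 h2 hatt hψ hψdiv hψC hψ1 hψ2
    one_pos hbound
  -- linearity of the three first variations in the direction: `X(ψ) = X(u) − X(V)`
  obtain ⟨iu1, -, -⟩ := integrable_stretching_coeffs_global hv hu hB hC h1 h1u
  obtain ⟨iV1, -, -⟩ := integrable_stretching_coeffs_global hv hV hB (fun x => by rw [hDV]; exact hB x) h1 (hVk 1 one_ne_zero h1)
  obtain ⟨au, -⟩ := integrable_enstrophy_coeffs_global hv hu h1 h1u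
  obtain ⟨aV, -⟩ := integrable_enstrophy_coeffs_global hv hV h1 (hVk 1 one_ne_zero h1)
  obtain ⟨cu, -⟩ := integrable_palinstrophy_coeffs_global hv hu h2 h2u
  obtain ⟨cV, -⟩ := integrable_palinstrophy_coeffs_global hv hV h2 (hVk 2 two_ne_zero h2)
  have hcurlψ : ∀ x, curl ψ x = curl u x - curl V x := fun x => by
    rw [hψeq, curl_add_smul hud hVd]
    simp only [neg_smul, one_smul, sub_eq_add_neg]
  have hDψ : ∀ x w, fderiv ℝ ψ x w = fderiv ℝ u x w - fderiv ℝ V x w := fun x w => by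
    rw [hDψ']; rfl
  have hDcurlψ : ∀ x w, fderiv ℝ (curl ψ) x w = fderiv ℝ (curl u) x w - fderiv ℝ (curl V) x w := fun x w => by
    rw [hψeq, fderiv_curl_add_smul hu hV]
    show fderiv ℝ (curl u) x w + (-1 : ℝ) • fderiv ℝ (curl V) x w = _
    rw [neg_one_smul, sub_eq_add_neg]
  have eJ : (∫ x, (⟪curl ψ x, fderiv ℝ v x (curl v x)⟫ + ⟪curl v x, fderiv ℝ ψ x (curl v x)⟫ + ⟪curl v x, fderiv ℝ v x (curl ψ x)⟫)) =
      (∫ x, (⟪curl u x, fderiv ℝ v x (curl v x)⟫ + ⟪curl v x, fderiv ℝ u x (curl v x)⟫ + ⟪curl v x, fderiv ℝ v x (curl u x)⟫)) -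
      ∫ x, (⟪curl V x, fderiv ℝ v x (curl v x)⟫ + ⟪curl v x, fderiv ℝ V x (curl v x)⟫ + ⟪curl v x, fderiv ℝ v x (curl V x)⟫) := by
    rw [← integral_sub iu1 iV1]
    congr 1; funext x
    simp only [hcurlψ, hDψ, inner_sub_left, inner_sub_right, map_sub]
    ring
  have eA : (∫ x, ⟪curl v x, curl ψ x⟫) = (∫ x, ⟪curl v x, curl u x⟫) - ∫ x, ⟪curl v x, curl V x⟫ := by
    rw [← integral_sub au aV]
    congr 1; funext x
    rw [hcurlψ, inner_sub_right]
  have eC : (∫ x, ∑ i, ⟪fderiv ℝ (curl v) x (EuclideanSpace.basisFun (Fin 3) ℝ i), fderiv ℝ (curl ψ) x (EuclideanSpace.basisFun (Fin 3) ℝ i)⟫) =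
      (∫ x, ∑ i, ⟪fderiv ℝ (curl v) x (EuclideanSpace.basisFun (Fin 3) ℝ i), fderiv ℝ (curl u) x (EuclideanSpace.basisFun (Fin 3) ℝ i)⟫) -
      ∫ x, ∑ i, ⟪fderiv ℝ (curl v) x (EuclideanSpace.basisFun (Fin 3) ℝ i), fderiv ℝ (curl V) x (EuclideanSpace.basisFun (Fin 3) ℝ i)⟫ := by
    rw [← integral_sub cu cV]
    congr 1; funext x
    rw [← Finset.sum_sub_distrib]
    exact Finset.sum_congr rfl fun i _ => by rw [hDcurlψ, inner_sub_right]
  rw [eJ, eA, eC, hVdef, firstVar_stretching_self v c, firstVar_enstrophy_self v c, firstVar_palinstrophy_self v c] at hmain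
  -- algebra
  have hZ0 : 0 ≤ ∫ x, ‖curl v x‖ ^ 2 := integral_nonneg fun x => sq_nonneg _
  have hW0 : 0 ≤ ∫ x, frobeniusNormSq (fderiv ℝ (curl v) x) := integral_nonneg fun x => frobeniusNormSq_nonneg _
  have e1 : K ^ 2 * M ^ 2 * (η / M * (∫ x, ‖curl v x‖ ^ 2) * (∫ x, frobeniusNormSq (fderiv ℝ (curl v) x))) =
      K ^ 2 * M * (∫ x, ‖curl v x‖ ^ 2) * (∫ x, frobeniusNormSq (fderiv ℝ (curl v) x)) * η := by
    field_simp
  nlinarith [hmain, e1]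

end ConvexKKT

end ExtremiserLiouville

end Summit.NavierStokesRegularity.NavierStokesRegularity.Theorems

end
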